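import Summits.QuantumFields.YangMills.Theorems.MirrorModularBoostsCurvatureBoostCovarianceParitySieve

/-!
# Sub-threshold ray growth kills the negative layers of a finite Laurent sum — stub `stub_laurentLayers`

Line `Sketch` of crux `MirrorModularBoosts.SoftKernelBoostCovariance` (stmt-QuantumFields-14999), stub (L3) of the
registered skeleton `Cruxes/SoftKernelBoostCovariance/Lines/Sketch.lean`.  Pure analysis over Mathlib.

**Statement.**  If the finite Laurent sum `χ ↦ Σ_{|k| ≤ K} p_k s^k` at `s = e^{-4χ}` satisfies
`‖Σ p_k s^k‖ ≤ C e^{cχ}` for all `χ ≥ 0` with `c < 8`, then `p_k = 0` for every `k ≤ -2`.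

**Proof.**  Upward induction on the bottom index (`layers_zero_of_growth`): if `p_j = 0` for all `j < k₀`, multiply
the sum by `s^{-k₀} = e^{4k₀χ}`; the product `Σ_{k ≥ k₀} p_k s^{k-k₀}` tends to `p_{k₀}` as `χ → +∞` (`s → 0`), and it is
bounded by `C e^{(c + 4k₀)χ} → 0` as soon as `c + 4k₀ < 0` (for `k₀ ≤ -2` and `c < 8`: `c + 4k₀ ≤ c - 8 < 0`); hence
`p_{k₀} = 0` (`bottom_coeff_zero`, the mirror image of the landed `Sieve.top_coeff_zero` of the parity sieve, with
exponential instead of bounded growth).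

References: folklore (uniqueness of the asymptotic layers of an exponential polynomial).
-/

noncomputable section

namespace Summit.QuantumFields.YangMills.Theorems.SoftKernelBoostCovariance.Sketch

open Filter Topology

/-- The base `s = e^{-4χ}` of the Laurent sum tends to `0` as `χ → +∞`. -/
theorem tendsto_exp_neg_four_mul : Tendsto (fun χ : ℝ => Real.exp (-4 * χ)) atTop (𝓝 0) :=
  Real.tendsto_exp_comp_nhds_zero.mpr (tendsto_id.const_mul_atTop_of_neg (by norm_num))

/-- Integer powers of the base are exponentials: `(e^{-4χ})^m = e^{-4mχ}`. -/
theorem exp_neg_four_mul_zpow (χ : ℝ) (m : ℤ) : Real.exp (-4 * χ) ^ m = Real.exp (-4 * m * χ) := by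
  rw [← Real.rpow_intCast, ← Real.exp_mul]
  congr 1
  ring

/-- **Bottom coefficient.**  If `‖Σ_{k ∈ [a, b]} p_k s^k‖ ≤ C e^{cχ}` at `s = e^{-4χ}` for all `χ ≥ 0` and
`c + 4a < 0`, then `p_a = 0`: the sum times `s^{-a}` tends to `p_a` and is `O(e^{(c + 4a)χ}) → 0`. -/
theorem bottom_coeff_zero (a b : ℤ) (hab : a ≤ b) (p : ℤ → ℂ) (C c : ℝ) (hca : c + 4 * a < 0)
    (hb : ∀ χ : ℝ, 0 ≤ χ →
      ‖∑ k ∈ Finset.Icc a b, p k * ((Real.exp (-4 * χ) : ℝ) : ℂ) ^ k‖ ≤ C * Real.exp (c * χ)) :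
    p a = 0 := by
  set g : ℝ → ℂ := fun χ =>
    (∑ k ∈ Finset.Icc a b, p k * ((Real.exp (-4 * χ) : ℝ) : ℂ) ^ k) *
      ((Real.exp (-4 * χ) : ℝ) : ℂ) ^ (-a) with hg
  have h1 : Tendsto g atTop (𝓝 (p a)) := by
    have hev : g = fun χ => ∑ k ∈ Finset.Icc a b, p k * ((Real.exp (-4 * χ) : ℝ) : ℂ) ^ (k - a) := by
      funext χ
      have hs0 : ((Real.exp (-4 * χ) : ℝ) : ℂ) ≠ 0 := Complex.ofReal_ne_zero.mpr (Real.exp_pos _).ne'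
      simp only [hg, Finset.sum_mul]
      refine Finset.sum_congr rfl fun k _ => ?_
      rw [mul_assoc, ← zpow_add₀ hs0, sub_eq_add_neg]
    rw [hev]
    have hlim : ∀ k ∈ Finset.Icc a b,
        Tendsto (fun χ : ℝ => p k * ((Real.exp (-4 * χ) : ℝ) : ℂ) ^ (k - a)) atTop
          (𝓝 (if k = a then p a else 0)) := by
      intro k hk
      by_cases hka : k = a
      · subst hka
        simp
      · have hpos : 0 < k - a := by
          have := (Finset.mem_Icc.mp hk).1
          omega
        rw [if_neg hka]
        have h0 : Tendsto (fun χ : ℝ => ((Real.exp (-4 * χ) : ℝ) : ℂ) ^ (k - a)) atTop (𝓝 0) := by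
          have hr : Tendsto (fun χ : ℝ => Real.exp (-4 * χ) ^ (k - a)) atTop (𝓝 0) := by
            have := tendsto_exp_neg_four_mul.zpow₀ (k - a) (Or.inr hpos.le)
            rwa [zero_zpow _ hpos.ne'] at this
          have := (Complex.continuous_ofReal.tendsto 0).comp hr
          simpa [Function.comp_def, Complex.ofReal_zpow] using this
        simpa using (tendsto_const_nhds (x := p k)).mul h0
    have := tendsto_finsetSum (Finset.Icc a b) hlim
    simpa [Finset.sum_ite_eq', Finset.mem_Icc, hab] using this
  have h2 : Tendsto g atTop (𝓝 0) := by
    have hbound : ∀ᶠ χ in atTop, ‖g χ‖ ≤ C * Real.exp (c * χ) * Real.exp (-4 * χ) ^ (-a) := by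
      filter_upwards [eventually_ge_atTop (0 : ℝ)] with χ hχ
      have hs0 : (0 : ℝ) < Real.exp (-4 * χ) := Real.exp_pos _
      rw [hg, norm_mul, norm_zpow, Complex.norm_real, Real.norm_of_nonneg hs0.le]
      exact mul_le_mul_of_nonneg_right (hb χ hχ) (zpow_nonneg hs0.le _)
    have heq : (fun χ : ℝ => C * Real.exp (c * χ) * Real.exp (-4 * χ) ^ (-a)) =
        fun χ => C * Real.exp ((c + 4 * a) * χ) := by
      funext χ
      rw [exp_neg_four_mul_zpow, mul_assoc, ← Real.exp_add,
        show c * χ + -4 * ((-a : ℤ) : ℝ) * χ = (c + 4 * a) * χ by push_cast; ring]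
    have hM : Tendsto (fun χ : ℝ => C * Real.exp (c * χ) * Real.exp (-4 * χ) ^ (-a)) atTop (𝓝 0) := by
      rw [heq]
      have hlin : Tendsto (fun χ : ℝ => (c + 4 * a) * χ) atTop atBot :=
        tendsto_id.const_mul_atTop_of_neg hca
      simpa using (Real.tendsto_exp_comp_nhds_zero.mpr hlin).const_mul C
    exact squeeze_zero_norm' hbound hM
  exact tendsto_nhds_unique h1 h2

/-- **Peeling from the bottom.**  Under the growth bound `‖Σ_{k ∈ [a, a + n]} p_k s^k‖ ≤ C e^{cχ}` (`s = e^{-4χ}`,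
`χ ≥ 0`), every layer `k ∈ [a, a + n]` with `c + 4k < 0` vanishes: induction on `n`, the bottom layer vanishes by
`bottom_coeff_zero` and is then dropped from the sum. -/
theorem layers_zero_of_growth (p : ℤ → ℂ) (C c : ℝ) :
    ∀ (n : ℕ) (a : ℤ),
      (∀ χ : ℝ, 0 ≤ χ →
        ‖∑ k ∈ Finset.Icc a (a + n), p k * ((Real.exp (-4 * χ) : ℝ) : ℂ) ^ k‖ ≤ C * Real.exp (c * χ)) →
      ∀ k ∈ Finset.Icc a (a + n), c + 4 * k < 0 → p k = 0 := by
  intro n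
  induction n with
  | zero =>
    intro a hb k hk hck
    have hka : k = a := by
      rw [Finset.mem_Icc] at hk
      omega
    rw [hka] at hck ⊢
    exact bottom_coeff_zero a _ (by simp) p C c hck hb
  | succ m ih =>
    intro a hb k hk hck
    have hkI := Finset.mem_Icc.mp hk
    -- the bottom layer vanishes
    have hbot : p a = 0 :=
      bottom_coeff_zero a _ (by omega) p C c (by
        have : (a : ℝ) ≤ k := by exact_mod_cast hkI.1
        linarith) hb
    by_cases hka : k = a
    · rw [hka]
      exact hbot
    · -- drop the bottom layer and recurse on `[a + 1, a + 1 + m]`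
      have hsub : Finset.Icc (a + 1) (a + 1 + m) ⊆ Finset.Icc a (a + (m + 1 : ℕ)) :=
        Finset.Icc_subset_Icc (by omega) (by omega)
      refine ih (a + 1) (fun χ hχ => ?_) k ?_ hck
      · have heq : ∑ k ∈ Finset.Icc (a + 1) (a + 1 + m), p k * ((Real.exp (-4 * χ) : ℝ) : ℂ) ^ k =
            ∑ k ∈ Finset.Icc a (a + (m + 1 : ℕ)), p k * ((Real.exp (-4 * χ) : ℝ) : ℂ) ^ k := by
          refine Finset.sum_subset hsub fun j hj hj' => ?_
          have hja : j = a := by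
            simp only [Finset.mem_Icc, not_and_or, not_le] at hj hj'
            omega
          rw [hja, hbot, zero_mul]
        rw [heq]
        exact hb χ hχ
      · rw [Finset.mem_Icc]
        omega

/-- **Stub (L3) — SUB-THRESHOLD RAY GROWTH KILLS THE NEGATIVE LAYERS OF A FINITE LAURENT SUM.**  If the Laurent sum
`χ ↦ Σ_{|k| ≤ K} p_k s^k` at `s = e^{-4χ}` is bounded by `C e^{cχ}` for all `χ ≥ 0` with `c < 8`, then `p_k = 0` for
every `k ≤ -2` (the most negative non-zero layer `k₀ ≤ -2` would dominate like `e^{-4k₀χ} ≥ e^{8χ}`).  The pencil is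
written exactly as in the landed `RayPositivity.pencil_eq_inner` (`((Real.exp (-4χ) : ℝ) : ℂ) ^ k`, `k : ℤ`). -/
theorem stub_laurentLayers :
    ∀ (K : ℕ) (p : ℤ → ℂ) (C c : ℝ), c < 8 →
      (∀ χ : ℝ, 0 ≤ χ →
        ‖∑ k ∈ Finset.Icc (-(K : ℤ)) K, p k * ((Real.exp (-4 * χ) : ℝ) : ℂ) ^ k‖ ≤ C * Real.exp (c * χ)) →
      ∀ k ∈ Finset.Icc (-(K : ℤ)) K, k ≤ -2 → p k = 0 := by
  intro K p C c hc hb k hk hk2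
  have hK : (K : ℤ) = -(K : ℤ) + ((2 * K : ℕ) : ℤ) := by
    push_cast
    ring
  refine layers_zero_of_growth p C c (2 * K) (-(K : ℤ)) (fun χ hχ => ?_) k ?_ ?_
  · rw [← hK]
    exact hb χ hχ
  · rw [← hK]
    exact hk
  · have : (k : ℝ) ≤ -2 := by exact_mod_cast hk2
    linarith

end Summit.QuantumFields.YangMills.Theorems.SoftKernelBoostCovariance.Sketch

end
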